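import Summits.QuantumFields.YangMills.Theorems.BalabanUVNodesN12AtRecord13Prop1KnitThm1WindowDirectDatumScaleLettersDischargedAtLengthOfThm1NamedFactsGOfRecord
import HarnessLib

/-!
# BalabanUVNodes ∕ N12 — THE REPAIRED WINDOW IS INHABITED: the NUMERIC display of the junction of record v14ᴸ is jointly satisfiable in the junction's own quantifier order
# (positive twin of the kernel certificate `BalabanUVNodesN12DirectWindowRadiusFloor` of ⚑ LOCATED «(J0′) × DIRECT: RADIUS COUPLING»; [Balaban1989LargeFieldI] (1.74) p.192,
# Prop. 1 p.194; [Balaban1989LargeFieldII] (1.12)–(1.13) p.359; [Balaban1985Variational] (7) p.278, Thm 1 (8) p.279)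

Cell `pub-ymgap` (HUMAN RULINGS D-0062 ∕ D-0149), seat `pub-ymgap-dag-n12-d` g29 (R134 N12 [B15] s2 = by-name knit at the record; count-neutral helper of K1⁹
`stmt-QuantumFields-27364`, `--kind proof --supports … --as helper`).  THEOREMS ONLY (0 `def`, 0 `instance`, 0 `sorry`); elementary real arithmetic over the DISPLAYED
numeric rows of the junction of record.  Nothing of the tree is refuted or strengthened; what is certified is that the rows a CONSUMER of the junction must meet CAN be met.

WHY.  dag-n12-d g27's certificate ✓p744117 `…N12DirectWindowRadiusFloor` (chair #10773) showed that the direct socket of record v12 T4 and the (J0′) head of record did NOT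
compose as typed: the socket's window `[C₁(d,L)·εreg + m′ρn, Thr(R)]` needs `4·10⁹·Θ.ν.εreg ≤ R²` while the head announced `∃ R` only AFTER the class threshold
(`false_of_directWindow_of_radius_le`).  The lane's RULING (B) «(8)-FLOOR» (dag-n12-c g31) and this seat's (B-T)∕(B-J) cascade (T1′–T4′, junction v13″ ✓p748139 → v14 ✓p751583 →
the lane's guard-generic v14ᴸ ✓p753865 = JUNCTION OF RECORD, plan g94 WORD (D1), chair #10983; this seat's L7 ✓p753864 = the K0⁷-currency pointer, rows token-identical) moved
the three tolerance floors to the DATUM scale `2·B₃·(cE+1)·eR_i`, instantiated the head ONCE per instance at a guard cap `eG_i` (radius `R_i` announced BEFORE the data budget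
`eR_i ≤ eG_i`) and announced the head's thresholds `ρJ εW δ₀` from εreg-blind numerics `ν₀` BEFORE `Θ`.  The memo `N12-RADIUS-COUPLING-2026-08-29.md` §8 then states «the radius
coupling is gone on the typed road» — by INSPECTION of the quantifier order.  THIS FILE is the kernel check of that sentence, and makes census item U4 kernel-explicit.

WHAT THIS FILE CERTIFIES (kernel).  §2 `exists_consumerChoices_numericRows_of_thresholds`: at ONE instance `(P, i)` of the junction of record — every displayed NUMERIC row
written VERBATIM with `x P i ↦ x`, `Θ.ν.M₁ ↦ M₁`, `Θ.ν.εreg ↦ εreg` — for EVERY value of the producer's ∃-announced thresholds `ρJ εW δ₀` and letter constants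
`C ρ Kτ ρτ ρ5 εH B₁ ρ6 M₂` (only the strict sign rows `0 < ρ ρτ ρ5 εH ρ6` are used), every `a₀ > 0, a₁′ > 0` ([15]'s names grant them), `1 ≤ Kb` (displayed) and ARBITRARY reals
`cE cA B₃ 𝓐₁`, the consumer has choices IN THE JUNCTION's ORDER:
`∃ εreg` (rows `hα3 hα2 haN hεreg ha₀`) → `∃ eG ρnG` (rows `heG hρJ1 hρJ2 hεWr hα3h hα2h haG ha₀s hρnG0 hT hnormG`) → `∀ R > 0` (the (J0′) radius, ARBITRARY) → `∃ eR ρn cJ δ`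
(rows `heR heRG hρn hcJ heRa hερ hερ6 hcJ' hδ hδle hfloor`).  So no displayed numeric row couples a later ∀-choice of the consumer to an earlier ∃-announcement of the producer
in the wrong direction any more: the window `[C₁·(2B₃(cE+1)eR) + m′ρn, min (Thr(R)) εH]` is met by taking `eR` small AFTER `R`.  §3 `classThreshold_le_of_capRows`: read
backwards, the cap rows bound the ONE class threshold by each instance's announced `εW`, `ρJ`, `δ₀` — the `δ₀`-bound with a coefficient GROWING with the instance's height `k`;
`not_exists_classThreshold_of_thresholds_below`: census U4 in the kernel — the SAME rows at a FAMILY of instances whose announced `εW P i` comes arbitrarily close to `0`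
admit NO class threshold `εreg > 0` (row `hεWr` is `∀ P i, Θ.ν.εreg ≤ εW P i` with ONE `εreg`); what the display still asks of the producers is a uniform-in-the-instance lower bound on `εW`, `ρJ` (and on `δ₀` against the
`εreg`-terms of `hT`) — print's numbers ([15] (8): constants «depending on d and L only») have it, the tree's ∃-constants do not yet say so (census U2∕U4, plan (r4) deferred).
ENVIRONMENT rows NOT in this game (they do not read `εreg, eG, ρnG, R, eR, ρn, cJ, δ`, or read only `ν₀.M₁`): `hM4 hM2 hdiv hcA hfit hZ1 hΩw hXΩ`, the geometry ∕ box rows, the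
tower rows `hres hpin hmassLive h180 h189`, the two guarded [15] names + `hadm₀` — untouched and unclaimed here.

HONEST FRAMING.  Three arithmetic theorems (+ a private `𝓝[>] 0` toolkit) over displayed rows; typing-strength ∕ A2-species certificate, count-neutral; nothing of Bałaban's
asserted or refuted; N12 NOT discharged; K0⁷ ∕ K1⁹ OPEN; counts unmoved (typed 28∕28 · discharged 8∕28, 8∕27 excl. NODE O); one finite 𝕋⁴ programme at fixed `ε = L^{-K}` —
R4 closes only the conditional rung `BalabanLadder.UV`; nothing continuum ∕ ℝ⁴ ∕ OS; the Yang–Mills mass gap (Clay) is NOT proved by any of this.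
-/

noncomputable section

namespace Summit.QuantumFields.YangMills.BalabanUVNodes.N12DirectWindowDatumScaleInhabited

open scoped BigOperators Topology
open Filter

/-! ## §1  Toolkit: rows linear in a small positive parameter hold eventually at `𝓝[>] 0` -/

/-- Eventually along `𝓝[>] 0` the parameter is positive. [folklore] -/
private theorem ev_pos : ∀ᶠ ε in 𝓝[>] (0 : ℝ), 0 < ε := eventually_mem_nhdsWithin

/-- Eventually along `𝓝[>] 0` the parameter is below any positive bound. [folklore] -/
private theorem ev_lt {b : ℝ} (hb : 0 < b) : ∀ᶠ ε in 𝓝[>] (0 : ℝ), ε < b := by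
  filter_upwards [Ioo_mem_nhdsGT hb] with ε hε using hε.2

/-- Eventually along `𝓝[>] 0` the parameter is at most any positive bound. [folklore] -/
private theorem ev_le {b : ℝ} (hb : 0 < b) : ∀ᶠ ε in 𝓝[>] (0 : ℝ), ε ≤ b :=
  (ev_lt hb).mono fun _ h => h.le

/-- Eventually along `𝓝[>] 0`, `c·ε < b` for any real `c` and positive `b`. [folklore] -/
private theorem ev_mul_lt (c : ℝ) {b : ℝ} (hb : 0 < b) : ∀ᶠ ε in 𝓝[>] (0 : ℝ), c * ε < b := by
  rcases le_or_gt c 0 with hc | hc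
  · filter_upwards [ev_pos] with ε hε
    nlinarith
  · filter_upwards [ev_lt (div_pos hb hc)] with ε hε
    have h := (lt_div_iff₀ hc).1 hε
    linarith

/-- Eventually along `𝓝[>] 0`, `c·ε ≤ b` for any real `c` and positive `b`. [folklore] -/
private theorem ev_mul_le (c : ℝ) {b : ℝ} (hb : 0 < b) : ∀ᶠ ε in 𝓝[>] (0 : ℝ), c * ε ≤ b :=
  (ev_mul_lt c hb).mono fun _ h => h.le

/-! ## §2  The consumer's winning choices at one instance of the junction of record v14ᴸ (`…LettersDischargedAtLengthOfThm1NamedFactsGOfRecord` ✓p753865; rows token-identical in v14 ✓p751583 ∕ L7 ✓p753864) -/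

open Literature.MathematicalPhysics.QuantumFieldTheory.Balaban1983to89
open Literature.MathematicalPhysics.QuantumFieldTheory.Balaban1983to89.T4Continuum (T4Family)
open Literature.MathematicalPhysics.QuantumFieldTheory.Balaban1983to89.Node00
open T4AxialGaugeSmallField (castSite)
open B16Eq18Proof (box)
open B14.Eq213DetSet (maxDomT)
open B8Eq17ClassAkV1 (plaqsOf)
open ExpMeanLog (deltaSU)

variable {F : T4Family}

/-- ★★★ **THE REPAIRED WINDOW IS INHABITED.**  At one instance `(P, i)` of the junction of record v14ᴸ (`x P i ↦ x`, `Θ.ν.M₁ ↦ M₁`, `Θ.ν.εreg ↦ εreg`), for every value of the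
producer's ∃-announced thresholds `ρJ εW δ₀ > 0` and letter constants `C ρ Kτ ρτ ρ5 εH B₁ ρ6 M₂` (only the STRICT displayed sign rows `0 < ρ, ρτ, ρ5, εH, ρ6` are used;
`a₀, a₁′ > 0` as [15]'s names grant; `1 ≤ Kb` as displayed; `cE cA B₃ 𝓐₁ C Kτ B₁ M₂` arbitrary reals), the consumer's numeric rows are met IN THE JUNCTION's ORDER:
a class threshold `εreg` (rows `hα3 hα2 haN hεreg ha₀`), then a guard cap `eG` with its datum tolerance `ρnG` (rows `heG hρJ1 hρJ2 hεWr hα3h hα2h haG ha₀s hρnG0 hT hnormG`),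
then — for EVERY radius `R > 0` the (J0′) head may announce — a data budget `eR ≤ eG`, tolerance `ρn`, bookkeeping constant `cJ` and endpoint tolerance `δ` (rows
`heR heRG hρn hcJ heRa hερ hερ6 hcJ' hδ hδle hfloor`).  Elementary: every row is linear in the small parameter of its stage with a positive right-hand side announced earlier,
so it holds eventually at `𝓝[>] 0`; finitely many rows per stage.  Typing-strength ∕ A2-species certificate; count-neutral; nothing of Bałaban's asserted.
[cite: Balaban1989LargeFieldI, (1.74) p.192, Prop. 1 (1.77)–(1.78) p.194; Balaban1989LargeFieldII, (1.12)–(1.13) p.359; Balaban1985Variational, (7) p.278, Thm 1 (8) p.279] -/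
theorem exists_consumerChoices_numericRows_of_thresholds (P : B12.RunParams) (Z : Set (Site (F.P P.K) 0)) (k n n' Kb M₁ : ℕ) (hK1 : 1 ≤ Kb)
    (lo hi : Fin (F.P P.K).d → ℤ) {cE cA B₃ a₀ a₁' 𝓐₁ : ℝ} (ha₀ : 0 < a₀) (ha₁' : 0 < a₁')
    -- the producer's ∃-announced thresholds `ρJ εW δ₀` and the nine letter constants `C ρ Kτ ρτ ρ5 εH B₁ ρ6 M₂` (ANY reals); of their nine displayed sign rows only the
    -- six STRICT ones are used — the signs of `C Kτ B₁ M₂` (and of `cE`, `B₃`, `cA`, `𝓐₁`) are NOT needed for satisfiability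
    {ρJ εW δ₀ C ρ Kτ ρτ ρ5 εH B₁ ρ6 M₂ : ℝ} (hρJ : 0 < ρJ) (hεW : 0 < εW) (hδ₀ : 0 < δ₀)
    (hρ : 0 < ρ) (hρτ : 0 < ρτ) (hρ5 : 0 < ρ5) (hεH : 0 < εH) (hρ6 : 0 < ρ6) :
    -- STAGE 1 (consumer): the class threshold `εreg` — rows `hα3 hα2 haN hεreg ha₀`
    ∃ εreg : ℝ,
      (143 * (((((F.P P.K).d + 4 : ℕ) : ℝ)) ^ 2 / 4) ^ 2) * (εreg * (F.P P.K).L ^ 2) ≤ 1 / 3 ∧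
      2 * (εreg * (F.P P.K).L ^ 2) ≤ 2 * deltaSU (Fin 2) / ((((F.P P.K).d + 4) * (F.P P.K).L : ℕ) : ℝ) ^ 2 ∧
      (((((F.P P.K).d + 2) * (F.P P.K).L : ℕ) : ℝ) ^ 2 / 4) * (2 * (εreg * (F.P P.K).L ^ 2)) < deltaSU (Fin 2) ∧
      0 < εreg ∧ εreg ≤ a₀ ∧
    -- STAGE 2 (consumer): the guard cap `eG` and the cap-level datum tolerance `ρnG` — rows `heG hρJ1 hρJ2 hεWr hα3h hα2h haG ha₀s hρnG0 hT hnormG`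
    ∃ eG ρnG : ℝ,
      0 < eG ∧
      6 * ((((F.P P.K).d - 1 : ℕ)) : ℝ) * (F.P P.K).L ^ k * (2 * ((cE + 1) * eG)) ≤ ρJ ∧
      12 * ((((F.P P.K).d - 1 : ℕ)) : ℝ) * (F.P P.K).L * εreg ≤ ρJ ∧
      εreg ≤ εW ∧
      (143 * (((((F.P P.K).d + 4 : ℕ) : ℝ)) ^ 2 / 4) ^ 2) * (2 * ((F.P P.K).L : ℝ) ^ 2 * εreg) ≤ 1 / 3 ∧
      2 * (2 * ((F.P P.K).L : ℝ) ^ 2 * εreg) ≤ 2 * deltaSU (Fin 2) / ((((F.P P.K).d + 4) * (F.P P.K).L : ℕ) : ℝ) ^ 2 ∧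
      ((cE + 1) * (2 * eG) ≤ a₁' ∧ B₃ * ((cE + 1) * (2 * eG)) ≤ εreg) ∧
      εreg < a₀ ∧
      0 ≤ ρnG ∧
      max ρnG ((((2 * (∑ i' ∈ Finset.range (k + 1), ((F.P P.K).d * (((F.P P.K).L ^ i' - 1) / 2) + 1)) + 1 +
            (3 * ((F.P P.K).d * (((F.P P.K).L - 1) / 2)) + 5) * (F.P P.K).L ^ k : ℕ) : ℝ)) ^ 2 / 4 * (εreg * (F.P P.K).eta 0 ^ 2) +
          ((3 * ((F.P P.K).d * (((F.P P.K).L - 1) / 2)) + 5 : ℕ) : ℝ) * (6 * ((((((F.P P.K).d + 2) * (F.P P.K).L : ℕ) : ℝ) ^ 2 / 4) * (2 * (εreg * (F.P P.K).L ^ 2))) *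
            ∑ i' ∈ Finset.range k, ((F.P P.K).L : ℝ) ^ i') + ((3 * ((F.P P.K).d * (((F.P P.K).L - 1) / 2)) + 5 : ℕ) : ℝ) * ρnG) ≤ δ₀ ∧
      (((F.P P.K).d : ℝ) * n' + 1) * ((((F.P P.K).d - 1 : ℕ) : ℝ) * n' * ((12 * (F.P P.K).d * (n + 2) ^ 2 + 1) * eG) + 3 * (F.P P.K).d * (n + 2) ^ 2 * eG) ≤ ρnG ∧
    -- STAGE 3 (producer): the (J0′) radius `R`, ARBITRARY — then STAGE 4 (consumer): `eR ρn cJ δ` — rows `heR heRG hρn hcJ heRa hερ hερ6 hcJ' hδ hδle hfloor`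
    ∀ R : ℝ, 0 < R →
    ∃ eR ρn cJ δ : ℝ,
      0 < eR ∧ eR ≤ eG ∧
      (((F.P P.K).d : ℝ) * n' + 1) * ((((F.P P.K).d - 1 : ℕ) : ℝ) * n' * ((12 * (F.P P.K).d * (n + 2) ^ 2 + 1) * eR) + 3 * (F.P P.K).d * (n + 2) ^ 2 * eR) ≤ ρn ∧
      0 ≤ cJ ∧
      ((cE + 1) * (2 * eR) ≤ a₁' ∧ B₃ * ((cE + 1) * (2 * eR)) ≤ εreg) ∧
      6 * ((((F.P P.K).d - 1 : ℕ)) : ℝ) * (F.P P.K).L * (2 * B₃ * (cE + 1) * eR) ≤ ρ5 ∧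
      6 * ((((F.P P.K).d - 1 : ℕ)) : ℝ) * (F.P P.K).L * (2 * B₃ * (cE + 1) * eR) ≤ ρ6 ∧
      2 * cA * eR / R + 2 * ((Nat.card {q : Plaq (F.P P.K) 0 // q ∈ plaqsOf (maxDomT M₁ Z 1)} : ℝ) * (1 + 8 * (4 * 𝓐₁) ^ 4)) / (R * eR) ≤ cJ ∧
      0 < δ ∧
      δ ≤ min (min (min ρ ρτ / 2)
        (min 1 (1 / 2 / (2 * (3 * (Kb : ℝ) ^ 2 + 2 * (Kb : ℝ) ^ 4)) /
          (max ((32 * (((F.P P.K).d : ℝ) - 1) + 8 * (((F.P P.K).d : ℝ) - 1) + (2 * (((F.P P.K).d : ℝ) - 1) * B₁ * (((∑ j ∈ Finset.range (k + 1), (2 * (F.P P.K).d) ^ j : ℕ) : ℝ) * M₂))) * (12 * (4 * 𝓐₁) / R * Real.sqrt (Nat.card {b : PBond (F.P P.K) 0 // b.src ∈ maxDomT M₁ Z 1})) ^ 2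
            + (8 * (((F.P P.K).d : ℝ) + 1) * (2 * (Kτ + 1)) + 8 * ((F.P P.K).d : ℝ) * (((box (fun κ => (hi κ - lo κ + 1).toNat + 3) (fun κ => lo κ - 2)).image (fun z => (castSite z : Site (F.P P.K) k))).card : ℝ) * (C * (12 * (4 * 𝓐₁) / R * Real.sqrt (Nat.card {b : PBond (F.P P.K) 0 // b.src ∈ maxDomT M₁ Z 1}))) ^ 2)) 0 + 1)))) εH ∧
      ((((4 * (F.P P.K).d + (3 * ((F.P P.K).d * (((F.P P.K).L - 1) / 2)) + 5) + 3 : ℕ) : ℝ)) ^ 2 * ((F.P P.K).L : ℝ) ^ 2 / 4 + ((3 * ((F.P P.K).d * (((F.P P.K).L - 1) / 2)) + 5 : ℕ) : ℝ) * (24 * (((((F.P P.K).d + 2) * (F.P P.K).L : ℕ) : ℝ) ^ 2 / 4))) * (2 * B₃ * (cE + 1) * eR) + ((3 * ((F.P P.K).d * (((F.P P.K).L - 1) / 2)) + 5 : ℕ) : ℝ) * ρn ≤ δ := by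
  -- names for the instance's fixed numbers
  set dR : ℝ := ((F.P P.K).d : ℝ) with hdR
  set LR : ℝ := ((F.P P.K).L : ℝ) with hLR
  set d1 : ℝ := ((((F.P P.K).d - 1 : ℕ)) : ℝ) with hd1
  set m' : ℝ := ((3 * ((F.P P.K).d * (((F.P P.K).L - 1) / 2)) + 5 : ℕ) : ℝ) with hm'
  set A4 : ℝ := ((((F.P P.K).d + 4 : ℕ) : ℝ)) with hA4
  set DL4 : ℝ := ((((F.P P.K).d + 4) * (F.P P.K).L : ℕ) : ℝ) with hDL4
  set DL2 : ℝ := (((((F.P P.K).d + 2) * (F.P P.K).L : ℕ) : ℝ)) with hDL2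
  set SQ : ℝ := (((2 * (∑ i' ∈ Finset.range (k + 1), ((F.P P.K).d * (((F.P P.K).L ^ i' - 1) / 2) + 1)) + 1 +
            (3 * ((F.P P.K).d * (((F.P P.K).L - 1) / 2)) + 5) * (F.P P.K).L ^ k : ℕ) : ℝ)) with hSQ
  set SL : ℝ := ∑ i' ∈ Finset.range k, ((F.P P.K).L : ℝ) ^ i' with hSL
  set η0 : ℝ := (F.P P.K).eta 0 with hη0
  set NN : ℝ := (dR * n' + 1) * (d1 * n' * (12 * dR * (n + 2) ^ 2 + 1) + 3 * dR * (n + 2) ^ 2) with hNN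
  set C₁ : ℝ := (((4 * (F.P P.K).d + (3 * ((F.P P.K).d * (((F.P P.K).L - 1) / 2)) + 5) + 3 : ℕ) : ℝ)) ^ 2 * LR ^ 2 / 4 + m' * (24 * (DL2 ^ 2 / 4)) with hC₁
  -- positivity of the two `deltaSU`-bounds' right-hand sides (the family's `L ≥ 12`)
  have hLn : 0 < (F.P P.K).L := by
    rw [T4Family.P_L]; have h := F.hL11; omega
  have hDL4pos : 0 < DL4 := by
    rw [hDL4]; exact_mod_cast Nat.mul_pos (by omega) hLn
  have hδSU : 0 < deltaSU (Fin 2) := ExpMeanLog.deltaSU_pos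
  have hB2 : 0 < 2 * deltaSU (Fin 2) / DL4 ^ 2 := by positivity
  have hNN0 : 0 ≤ NN := by rw [hNN]; positivity
  have hm'0 : 0 ≤ m' := by rw [hm']; positivity
  -- STAGE 1: the class threshold (every row linear in `ε` with a positive right-hand side announced before `Θ`)
  have hev₁ : ∀ᶠ ε in 𝓝[>] (0 : ℝ),
      (143 * ((A4) ^ 2 / 4) ^ 2) * (ε * LR ^ 2) ≤ 1 / 3 ∧
      2 * (ε * LR ^ 2) ≤ 2 * deltaSU (Fin 2) / DL4 ^ 2 ∧
      (DL2 ^ 2 / 4) * (2 * (ε * LR ^ 2)) < deltaSU (Fin 2) ∧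
      0 < ε ∧ ε ≤ a₀ ∧
      12 * d1 * LR * ε ≤ ρJ ∧ ε ≤ εW ∧
      (143 * ((A4) ^ 2 / 4) ^ 2) * (2 * LR ^ 2 * ε) ≤ 1 / 3 ∧
      2 * (2 * LR ^ 2 * ε) ≤ 2 * deltaSU (Fin 2) / DL4 ^ 2 ∧
      ε < a₀ ∧
      SQ ^ 2 / 4 * (ε * η0 ^ 2) ≤ δ₀ / 4 ∧
      m' * (6 * ((DL2 ^ 2 / 4) * (2 * (ε * LR ^ 2))) * SL) ≤ δ₀ / 4 := by
    have hδ₀4 : 0 < δ₀ / 4 := by positivity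
    filter_upwards [ev_mul_le (143 * ((A4) ^ 2 / 4) ^ 2 * LR ^ 2) (show (0:ℝ) < 1 / 3 by norm_num),
      ev_mul_le (2 * LR ^ 2) hB2, ev_mul_lt (DL2 ^ 2 / 4 * (2 * LR ^ 2)) hδSU, ev_pos, ev_le ha₀,
      ev_mul_le (12 * d1 * LR) hρJ, ev_le hεW, ev_mul_le (143 * ((A4) ^ 2 / 4) ^ 2 * (2 * LR ^ 2)) (show (0:ℝ) < 1 / 3 by norm_num),
      ev_mul_le (2 * (2 * LR ^ 2)) hB2, ev_lt ha₀, ev_mul_le (SQ ^ 2 / 4 * η0 ^ 2) hδ₀4,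
      ev_mul_le (m' * (6 * ((DL2 ^ 2 / 4) * (2 * LR ^ 2)) * SL)) hδ₀4]
      with ε h1 h2 h3 h4 h5 h6 h7 h8 h9 h10 h11 h12
    exact ⟨by linarith only [h1], by linarith only [h2], by linarith only [h3], h4, h5, by linarith only [h6], h7, by linarith only [h8],
      by linarith only [h9], h10, by linarith only [h11], by linarith only [h12]⟩
  obtain ⟨εreg, r1, r2, r3, hεreg, r5, r6, r7, r8, r9, r10, rQ, rW⟩ := hev₁.exists
  refine ⟨εreg, r1, r2, r3, hεreg, r5, ?_⟩
  -- STAGE 2: the guard cap and its datum tolerance (rows linear in `eG`; `ρnG :=` the normaliser's bound itself)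
  have hev₂ : ∀ᶠ e in 𝓝[>] (0 : ℝ),
      0 < e ∧
      6 * d1 * LR ^ k * (2 * ((cE + 1) * e)) ≤ ρJ ∧
      (cE + 1) * (2 * e) ≤ a₁' ∧ B₃ * ((cE + 1) * (2 * e)) ≤ εreg ∧
      NN * e ≤ δ₀ ∧ m' * (NN * e) ≤ δ₀ / 4 := by
    have hδ₀4 : 0 < δ₀ / 4 := by positivity
    filter_upwards [ev_pos, ev_mul_le (6 * d1 * LR ^ k * (2 * (cE + 1))) hρJ, ev_mul_le ((cE + 1) * 2) ha₁', ev_mul_le (B₃ * ((cE + 1) * 2)) hεreg,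
      ev_mul_le NN hδ₀, ev_mul_le (m' * NN) hδ₀4] with e h1 h2 h3 h4 h5 h6
    exact ⟨h1, by linarith only [h2], by linarith only [h3], by linarith only [h4], h5, by linarith only [h6]⟩
  obtain ⟨eG, heG, g1, g2, g3, g4, g5⟩ := hev₂.exists
  have hρnG : (dR * n' + 1) * (d1 * n' * ((12 * dR * (n + 2) ^ 2 + 1) * eG) + 3 * dR * (n + 2) ^ 2 * eG) = NN * eG := by rw [hNN]; ring
  refine ⟨eG, (dR * n' + 1) * (d1 * n' * ((12 * dR * (n + 2) ^ 2 + 1) * eG) + 3 * dR * (n + 2) ^ 2 * eG),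
    heG, g1, r6, r7, r8, r9, ⟨g2, g3⟩, r10, ?_, ?_, le_rfl, ?_⟩
  · rw [hρnG]; positivity
  · rw [hρnG]
    exact max_le g4 (by linarith only [rQ, rW, g5, hδ₀])
  -- STAGE 3 ∕ 4: for EVERY radius the head announces — the data budget, its tolerance, the bookkeeping constant, the endpoint tolerance
  intro R hR
  have hKb0 : (0 : ℝ) < (Kb : ℝ) := by exact_mod_cast hK1
  have hden : ∀ x : ℝ, 0 < max x 0 + 1 := fun x => by
    have hx : (0 : ℝ) ≤ max x 0 := le_max_right _ _
    linarith only [hx]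
  -- the endpoint's explicit threshold at this radius is POSITIVE: `δ :=` it
  obtain ⟨Thr, hThr0, hThrle⟩ : ∃ T : ℝ, 0 < T ∧ T ≤ min (min (min ρ ρτ / 2)
        (min 1 (1 / 2 / (2 * (3 * (Kb : ℝ) ^ 2 + 2 * (Kb : ℝ) ^ 4)) /
          (max ((32 * (dR - 1) + 8 * (dR - 1) + (2 * (dR - 1) * B₁ * (((∑ j ∈ Finset.range (k + 1), (2 * (F.P P.K).d) ^ j : ℕ) : ℝ) * M₂))) * (12 * (4 * 𝓐₁) / R * Real.sqrt (Nat.card {b : PBond (F.P P.K) 0 // b.src ∈ maxDomT M₁ Z 1})) ^ 2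
            + (8 * (dR + 1) * (2 * (Kτ + 1)) + 8 * dR * (((box (fun κ => (hi κ - lo κ + 1).toNat + 3) (fun κ => lo κ - 2)).image (fun z => (castSite z : Site (F.P P.K) k))).card : ℝ) * (C * (12 * (4 * 𝓐₁) / R * Real.sqrt (Nat.card {b : PBond (F.P P.K) 0 // b.src ∈ maxDomT M₁ Z 1}))) ^ 2)) 0 + 1)))) εH :=
    ⟨_, lt_min (lt_min (by positivity) (lt_min one_pos (div_pos (by positivity) (hden _)))) hεH, le_rfl⟩
  have hev₄ : ∀ᶠ e in 𝓝[>] (0 : ℝ),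
      0 < e ∧ e ≤ eG ∧
      (cE + 1) * (2 * e) ≤ a₁' ∧ B₃ * ((cE + 1) * (2 * e)) ≤ εreg ∧
      6 * d1 * LR * (2 * B₃ * (cE + 1) * e) ≤ ρ5 ∧
      6 * d1 * LR * (2 * B₃ * (cE + 1) * e) ≤ ρ6 ∧
      C₁ * (2 * B₃ * (cE + 1) * e) ≤ Thr / 2 ∧ m' * (NN * e) ≤ Thr / 2 := by
    have hThr2 : 0 < Thr / 2 := by positivity
    filter_upwards [ev_pos, ev_le heG, ev_mul_le ((cE + 1) * 2) ha₁', ev_mul_le (B₃ * ((cE + 1) * 2)) hεreg,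
      ev_mul_le (6 * d1 * LR * (2 * B₃ * (cE + 1))) hρ5, ev_mul_le (6 * d1 * LR * (2 * B₃ * (cE + 1))) hρ6,
      ev_mul_le (C₁ * (2 * B₃ * (cE + 1))) hThr2, ev_mul_le (m' * NN) hThr2] with e h1 h2 h3 h4 h5 h6 h7 h8
    exact ⟨h1, h2, by linarith only [h3], by linarith only [h4], by linarith only [h5], by linarith only [h6], by linarith only [h7],
      by linarith only [h8]⟩
  obtain ⟨eR, heR, e1, e2, e3, e4, e5, e6, e7⟩ := hev₄.exists
  have hρn : (dR * n' + 1) * (d1 * n' * ((12 * dR * (n + 2) ^ 2 + 1) * eR) + 3 * dR * (n + 2) ^ 2 * eR) = NN * eR := by rw [hNN]; ring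
  refine ⟨eR, (dR * n' + 1) * (d1 * n' * ((12 * dR * (n + 2) ^ 2 + 1) * eR) + 3 * dR * (n + 2) ^ 2 * eR),
    max 0 (2 * cA * eR / R + 2 * ((Nat.card {q : Plaq (F.P P.K) 0 // q ∈ plaqsOf (maxDomT M₁ Z 1)} : ℝ) * (1 + 8 * (4 * 𝓐₁) ^ 4)) / (R * eR)), Thr,
    heR, e1, le_rfl, le_max_left _ _, ⟨e2, e3⟩, e4, e5, le_max_right _ _, hThr0, hThrle, ?_⟩
  rw [hρn]
  linarith only [e6, e7]

/-! ## §3  Census U4 in the kernel: the same rows at a FAMILY of instances need the announced thresholds bounded below uniformly in the instance -/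

/-- ★★ **WHAT THE CAP ROWS ASK OF THE ONE CLASS THRESHOLD, PER INSTANCE.**  Read backwards, the junction's rows `hεWr`, `hρJ2`, `hρnG0`, `hT` at an instance `(P, i)`
(`x P i ↦ x`, `Θ.ν.εreg ↦ εreg`) bound the class threshold by that instance's announced thresholds: `εreg ≤ εW`, `12(d−1)L·εreg ≤ ρJ`, and
`(SQ²∕4·η₀² + m′·(6·((d+2)L)²∕4·2L²)·Σ_{i'<k} L^{i'})·εreg ≤ δ₀` with `SQ = 2Σ_{i'≤k}(d(L^{i'}−1)∕2+1) + 1 + m′L^k` — a coefficient that GROWS with the instance's height `k`.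
Since `hεWr ∕ hρJ2 ∕ hT` are `∀ P i` rows against ONE `Θ.ν.εreg`, a family of instances is served only if `εW P i`, `ρJ P i` are bounded below and `δ₀ P i` dominates that
`k P i`-growing coefficient UNIFORMLY in `(P, i)` — census U4 (∃-constants, k-dependence) as a kernel sentence; the producers' thresholds are functions of
`(ν₀, P.K, Z P i, k P i)` whose uniformity the tree does not yet state.  Count-neutral; nothing of Bałaban's asserted.
[cite: Balaban1989LargeFieldI, Prop. 1 (1.77)–(1.78) p.194 (`e0` after the instance, `B₅` uniform); Balaban1985Variational, Thm 1 (8) p.279] -/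
theorem classThreshold_le_of_capRows (P : B12.RunParams) (k : ℕ) {εreg ρJ εW δ₀ ρnG : ℝ}
    (hεWr : εreg ≤ εW)
    (hρJ2 : 12 * ((((F.P P.K).d - 1 : ℕ)) : ℝ) * (F.P P.K).L * εreg ≤ ρJ)
    (hρnG0 : 0 ≤ ρnG)
    (hT : max ρnG ((((2 * (∑ i' ∈ Finset.range (k + 1), ((F.P P.K).d * (((F.P P.K).L ^ i' - 1) / 2) + 1)) + 1 +
            (3 * ((F.P P.K).d * (((F.P P.K).L - 1) / 2)) + 5) * (F.P P.K).L ^ k : ℕ) : ℝ)) ^ 2 / 4 * (εreg * (F.P P.K).eta 0 ^ 2) +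
          ((3 * ((F.P P.K).d * (((F.P P.K).L - 1) / 2)) + 5 : ℕ) : ℝ) * (6 * ((((((F.P P.K).d + 2) * (F.P P.K).L : ℕ) : ℝ) ^ 2 / 4) * (2 * (εreg * (F.P P.K).L ^ 2))) *
            ∑ i' ∈ Finset.range k, ((F.P P.K).L : ℝ) ^ i') + ((3 * ((F.P P.K).d * (((F.P P.K).L - 1) / 2)) + 5 : ℕ) : ℝ) * ρnG) ≤ δ₀) :
    εreg ≤ εW ∧ 12 * ((((F.P P.K).d - 1 : ℕ)) : ℝ) * (F.P P.K).L * εreg ≤ ρJ ∧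
      ((((2 * (∑ i' ∈ Finset.range (k + 1), ((F.P P.K).d * (((F.P P.K).L ^ i' - 1) / 2) + 1)) + 1 +
            (3 * ((F.P P.K).d * (((F.P P.K).L - 1) / 2)) + 5) * (F.P P.K).L ^ k : ℕ) : ℝ)) ^ 2 / 4 * (F.P P.K).eta 0 ^ 2 +
        ((3 * ((F.P P.K).d * (((F.P P.K).L - 1) / 2)) + 5 : ℕ) : ℝ) * (6 * ((((((F.P P.K).d + 2) * (F.P P.K).L : ℕ) : ℝ) ^ 2 / 4) * (2 * ((F.P P.K).L : ℝ) ^ 2)) *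
          ∑ i' ∈ Finset.range k, ((F.P P.K).L : ℝ) ^ i')) * εreg ≤ δ₀ := by
  refine ⟨hεWr, hρJ2, ?_⟩
  have h2 := le_of_max_le_right hT
  have hm : (0 : ℝ) ≤ ((3 * ((F.P P.K).d * (((F.P P.K).L - 1) / 2)) + 5 : ℕ) : ℝ) * ρnG := by positivity
  linarith [h2, hm]

/-- ★ **NO CLASS THRESHOLD SERVES A FAMILY WHOSE ANNOUNCED `εW` HAS INFIMUM ZERO.**  The junction's row `hεWr : ∀ P i, Θ.ν.εreg ≤ εW P i` carries ONE class threshold for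
ALL instances; if the producer's `εW P i` (a function of `(P.K, k P i, Z P i, ν₀, [15]'s constants)`) comes arbitrarily close to `0` along the family, no `Θ.ν.εreg > 0` meets
`hεreg ∧ hεWr` (the same holds verbatim for `hρJ2` and for `hT`'s `εreg`-terms against `δ₀ P i`).  This is census item U4 (uniformity of the producers' constants in the
instance ∕ run, print's «constants depending on d and L only») as a kernel sentence; nothing of Bałaban's asserted; count-neutral.
[cite: Balaban1985Variational, Thm 1 (8) p.279 (constants depend on d, L only); Balaban1989LargeFieldI, Prop. 1 (1.77)–(1.78) p.194] -/
theorem not_exists_classThreshold_of_thresholds_below {ι : B12.RunParams → Type*} (εW : ∀ P : B12.RunParams, ι P → ℝ)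
    (hbelow : ∀ ε : ℝ, 0 < ε → ∃ (P : B12.RunParams) (i : ι P), εW P i < ε) :
    ¬ ∃ εreg : ℝ, 0 < εreg ∧ ∀ (P : B12.RunParams) (i : ι P), εreg ≤ εW P i := by
  rintro ⟨εreg, hεreg, hle⟩
  obtain ⟨P, i, hi⟩ := hbelow εreg hεreg
  exact lt_irrefl _ ((hle P i).trans_lt hi)

end Summit.QuantumFields.YangMills.BalabanUVNodes.N12DirectWindowDatumScaleInhabited

end
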